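import Mathlib.LinearAlgebra.Matrix.Charpoly.Coeff
import Mathlib.LinearAlgebra.Matrix.GeneralLinearGroup.Defs
import Mathlib.LinearAlgebra.Matrix.NonsingularInverse
import Mathlib.LinearAlgebra.Dimension.Constructions
import Mathlib.RingTheory.Adjoin.Polynomial.Basic
import Mathlib.Algebra.Polynomial.Roots
import Literature.NumberTheory.Automorphic.QuaternionAlgebraCentralizer
import HarnessLib

/-!
# Conjugacy classes and centralisers of non-scalar elements of `M₂(F)` and `GL₂(F)`
(rational canonical form in dimension `2`; Gelbart, *Automorphic forms on adele groups* (1975),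
p. 150 and pp. 154–155: the elliptic Cartan subgroups `E^× ↪ GL(2, F)` and the indexing of the
elliptic conjugacy classes of `GL(2, F)` by quadratic extensions `E = F(γ)`)

Topic `NumberTheory/Automorphic`; theorems only (no definition, no named fact, no instance). The
`GL(2)` twin of `QuaternionConjugacy` / `QuaternionAlgebraCentralizer` (which treat the division
quaternion algebras): the bookkeeping of the elliptic terms of the trace formula for `GL(2)`
(Gelbart (9.13), Cor. 9.24, (10.15), (10.18)) needs, for a field `F` and a **non-scalar**
`A ∈ M₂(F)` (`A ∉ F · 1`, i.e. `A ∉ ⊥`):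

* over any commutative ring `R` (so that the lemmas also serve the adelic points `M₂(𝔸_K)`):
  `matrixTwo_mul_self` (Cayley–Hamilton, `A² = tr(A) A - det(A)`),
  `mul_cyclic_eq_cyclic_mul_companion` (`A [v | Av] = [v | Av] C_A` with the **companion matrix**
  `C_A = !![0, -det A; 1, tr A]`), `commute_companion_iff` /
  `exists_eq_smul_one_add_smul_companion_of_commute` (the commutant of a companion matrix
  `!![0, -n; 1, t]` is `R · 1 + R · C`), `exists_eq_smul_one_add_smul_of_commute_of_conj_companion`
  (hence the commutant of any `A` conjugate to a companion matrix by a matrix of unit determinant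
  is `R · 1 + R · A`), `inv_eq_smul_of_isUnit_det` / `inv_mem_adjoin_singleton_of_isUnit_det`
  (`A⁻¹ = det(A)⁻¹ (tr(A) - A) ∈ R[A]`), `mem_adjoin_singleton_iff_exists` (`R[A] = R · 1 + R · A`);
* over a field `F`: `matrixTwo_mem_bot_iff` (scalar iff `A₀₁ = A₁₀ = 0`, `A₀₀ = A₁₁`),
  `exists_det_cyclic_ne_zero`, `exists_conj_eq_companion` — a non-scalar `A` has a cyclic vector
  and is conjugate to the companion matrix of `X² - tr(A) X + det(A)` (rational canonical form);
* `exists_units_conj_eq_of_trace_eq_of_det_eq`, `isConj_iff_trace_eq_and_det_eq` — **two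
  non-scalar elements of `M₂(F)` (of `GL₂(F)`) are conjugate under `GL₂(F)` iff they have the same
  trace and determinant** (for `GL₂(F)`: `IsConj`), the `GL(2)` side of the parametrisation of
  conjugacy classes by characteristic polynomials (Gelbart p. 150: "by the theorem of
  Skolem-Noether this imbedding is uniquely determined up to inner automorphism"; p. 155: the
  classes `γ ∈ Z_F \ B_F`, `B_F = B_F(E)`, indexed by the quadratic extensions `E`);
* `centralizer_singleton_eq_adjoin_of_not_mem_bot`, `finrank_adjoin_singleton_eq_two_of_not_mem_bot`
  — **the centraliser of a non-scalar `A` in `M₂(F)` is `F[A] = F + F A`, of dimension `2`**;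
* `glTwo_centralizer_singleton_eq` — **in `GL₂(F)` the centraliser of a non-scalar `γ` is
  `F[γ]^×`** (`(F[γ]).toSubmonoid.units`; Gelbart p. 154: `B_F(E)`, the centraliser of
  `E = F(γ)` in `G_F`, is `E^×`);
* `not_mem_bot_of_irreducible_charpoly`, `isUnit_of_mem_adjoin_singleton_of_ne_zero`,
  `adjoin_singleton_isField_of_irreducible_charpoly`, `isConj_iff_of_irreducible_charpoly` — the
  **elliptic** case: if the characteristic polynomial of `γ` is irreducible over `F` then `γ` is
  non-scalar, `F[γ]` is a (quadratic) field all of whose non-zero elements are units of `M₂(F)`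
  (so `B_F = E^×` is an elliptic Cartan subgroup, Gelbart p. 150), and *every* `γ'` with the same
  trace and determinant is conjugate to `γ`.

All proofs are elementary `2 × 2` linear algebra (entries, `Matrix.trace_fin_two`,
`Matrix.det_fin_two`). A brick of the inline (D-0026) decomposition of
`Literature.NumberTheory.Automorphic.strong_multiplicity_one_quaternionUnits` (Gelbart Thm. 10.5):
the comparison (10.14) = (10.15) matches the elliptic classes of `GL₂(K)` and the non-central
classes of `D^×` through `(tr, det) = (trd, nrd)`, and the adelic centralisers `B_𝔸(E)` are
computed from the commutant of the companion matrix over `R = 𝔸_K`.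

## References

* S. Gelbart, *Automorphic forms on adele groups*, Ann. of Math. Studies 83 (1975), p. 150
  (elliptic Cartan subgroups of `GL(2, F_v)`), pp. 154–155 ((10.17)–(10.18)) [Gelbart1975].
* H. Jacquet, R. P. Langlands, *Automorphic forms on GL(2)*, LNM 114 (1970), §7 and §16
  [JacquetLanglands1970].
-/

open Matrix Polynomial Module

namespace Literature.NumberTheory.Automorphic

/-! ### Over a commutative ring: Cayley–Hamilton, companion matrices and their commutant -/

section CommRing

variable {R : Type*} [CommRing R]

/-- **Cayley–Hamilton for `2 × 2` matrices**: `A² = tr(A) A - det(A) · 1`. [folklore] -/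
theorem matrixTwo_mul_self (A : Matrix (Fin 2) (Fin 2) R) :
    A * A = A.trace • A - A.det • (1 : Matrix (Fin 2) (Fin 2) R) := by
  ext i j
  fin_cases i <;> fin_cases j <;>
    simp [Matrix.mul_apply, Fin.sum_univ_two, Matrix.trace_fin_two, Matrix.det_fin_two] <;> ring

/-- **`A [v | Av] = [v | Av] C_A`** with `C_A = !![0, -det A; 1, tr A]` the companion matrix of
`X² - tr(A) X + det(A)`: the second column is Cayley–Hamilton, `A² v = tr(A) Av - det(A) v`.
[folklore] -/
theorem mul_cyclic_eq_cyclic_mul_companion (A : Matrix (Fin 2) (Fin 2) R) (v : Fin 2 → R) :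
    A * !![v 0, (A *ᵥ v) 0; v 1, (A *ᵥ v) 1] =
      !![v 0, (A *ᵥ v) 0; v 1, (A *ᵥ v) 1] * !![0, -A.det; 1, A.trace] := by
  ext i j
  fin_cases i <;> fin_cases j <;>
    simp [Matrix.mul_apply, Fin.sum_univ_two, Matrix.mulVec, dotProduct, Matrix.trace_fin_two,
      Matrix.det_fin_two] <;> ring

/-- `P⁻¹ A P = C` from `A P = P C` for `P` of unit determinant. [folklore] -/
theorem inv_mul_mul_eq_of_mul_eq_mul {A P C : Matrix (Fin 2) (Fin 2) R} (hP : IsUnit P.det)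
    (h : A * P = P * C) : P⁻¹ * A * P = C := by
  rw [Matrix.mul_assoc, h, ← Matrix.mul_assoc, Matrix.nonsing_inv_mul _ hP, Matrix.one_mul]

/-- **The commutant of a companion matrix**: `B` commutes with `!![0, -n; 1, t]` iff
`B₀₁ = -n B₁₀` and `B₁₁ = B₀₀ + t B₁₀`, i.e. iff `B = B₀₀ · 1 + B₁₀ · !![0, -n; 1, t]`. [folklore] -/
theorem commute_companion_iff (t n : R) (B : Matrix (Fin 2) (Fin 2) R) :
    !![0, -n; 1, t] * B = B * !![0, -n; 1, t] ↔ B 0 1 = -(n * B 1 0) ∧ B 1 1 = B 0 0 + t * B 1 0 := by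
  constructor
  · intro h
    have h00 := congrFun (congrFun h 0) 0
    have h10 := congrFun (congrFun h 1) 0
    simp [Matrix.mul_apply, Fin.sum_univ_two] at h00 h10
    exact ⟨by linear_combination -h00, by linear_combination -h10⟩
  · rintro ⟨h1, h2⟩
    ext i j
    fin_cases i <;> fin_cases j <;> simp [Matrix.mul_apply, Fin.sum_univ_two, h1, h2] <;> ring

/-- A matrix commuting with the companion matrix `C = !![0, -n; 1, t]` is `p · 1 + r · C` for
some `p, r ∈ R` (namely `p = B₀₀`, `r = B₁₀`). [folklore] -/
theorem exists_eq_smul_one_add_smul_companion_of_commute {t n : R} {B : Matrix (Fin 2) (Fin 2) R}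
    (h : !![0, -n; 1, t] * B = B * !![0, -n; 1, t]) :
    ∃ p r : R, B = p • (1 : Matrix (Fin 2) (Fin 2) R) + r • !![0, -n; 1, t] := by
  obtain ⟨h1, h2⟩ := (commute_companion_iff t n B).mp h
  refine ⟨B 0 0, B 1 0, ?_⟩
  ext i j
  fin_cases i <;> fin_cases j <;> simp [h1, h2] <;> ring

/-- **The commutant of a matrix conjugate to a companion matrix is `R · 1 + R · A`**: if
`P⁻¹ A P = !![0, -n; 1, t]` with `det P` a unit, then every `B` with `A B = B A` is
`p · 1 + r · A` (conjugate `B` to the commutant of the companion matrix and back). Over `R = 𝔸_K`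
this computes the adelic centraliser `B_𝔸(E)` of Gelbart (1975), p. 154. [folklore] -/
theorem exists_eq_smul_one_add_smul_of_commute_of_conj_companion {A P : Matrix (Fin 2) (Fin 2) R}
    {t n : R} (hP : IsUnit P.det) (hPA : P⁻¹ * A * P = !![0, -n; 1, t])
    {B : Matrix (Fin 2) (Fin 2) R} (hc : A * B = B * A) :
    ∃ p r : R, B = p • (1 : Matrix (Fin 2) (Fin 2) R) + r • A := by
  -- `P⁻¹ B P` commutes with the companion matrix `P⁻¹ A P`
  have hcomm : !![0, -n; 1, t] * (P⁻¹ * B * P) = (P⁻¹ * B * P) * !![0, -n; 1, t] := by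
    rw [← hPA]
    have e1 : P⁻¹ * A * P * (P⁻¹ * B * P) = P⁻¹ * (A * B) * P := by
      rw [Matrix.mul_assoc (P⁻¹ * A), ← Matrix.mul_assoc P, ← Matrix.mul_assoc P,
        Matrix.mul_nonsing_inv _ hP, Matrix.one_mul]
      simp only [Matrix.mul_assoc]
    have e2 : P⁻¹ * B * P * (P⁻¹ * A * P) = P⁻¹ * (B * A) * P := by
      rw [Matrix.mul_assoc (P⁻¹ * B), ← Matrix.mul_assoc P, ← Matrix.mul_assoc P,
        Matrix.mul_nonsing_inv _ hP, Matrix.one_mul]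
      simp only [Matrix.mul_assoc]
    rw [e1, e2, hc]
  obtain ⟨p, r, hform⟩ := exists_eq_smul_one_add_smul_companion_of_commute hcomm
  -- conjugate back: `B = P (P⁻¹ B P) P⁻¹ = p · 1 + r · A`
  have hB' : B = P * (P⁻¹ * B * P) * P⁻¹ := by
    rw [← Matrix.mul_assoc, ← Matrix.mul_assoc, Matrix.mul_nonsing_inv _ hP, Matrix.one_mul,
      Matrix.mul_assoc, Matrix.mul_nonsing_inv _ hP, Matrix.mul_one]
  have hA' : A = P * !![0, -n; 1, t] * P⁻¹ := by
    rw [← hPA, ← Matrix.mul_assoc, ← Matrix.mul_assoc, Matrix.mul_nonsing_inv _ hP,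
      Matrix.one_mul, Matrix.mul_assoc, Matrix.mul_nonsing_inv _ hP, Matrix.mul_one]
  refine ⟨p, r, ?_⟩
  rw [hB', hform, Matrix.mul_add, Matrix.mul_smul, Matrix.mul_smul, Matrix.mul_one, Matrix.add_mul,
    Matrix.smul_mul, Matrix.smul_mul, Matrix.mul_nonsing_inv _ hP, ← hA']

/-- `p · 1 + r · A` commutes with `A`. [folklore] -/
theorem smul_one_add_smul_mul_comm (A : Matrix (Fin 2) (Fin 2) R) (p r : R) :
    A * (p • (1 : Matrix (Fin 2) (Fin 2) R) + r • A) = (p • (1 : Matrix (Fin 2) (Fin 2) R) + r • A) * A := by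
  rw [Matrix.mul_add, Matrix.add_mul, Matrix.mul_smul, Matrix.smul_mul, Matrix.mul_one,
    Matrix.one_mul, Matrix.mul_smul, Matrix.smul_mul]

/-- **`A⁻¹ = det(A)⁻¹ (tr(A) · 1 - A)`** for a `2 × 2` matrix of unit determinant
(Cayley–Hamilton: `A (tr A - A) = det A`). [folklore] -/
theorem inv_eq_smul_of_isUnit_det {A : Matrix (Fin 2) (Fin 2) R} (hu : IsUnit A.det) :
    A⁻¹ = ((hu.unit⁻¹ : Rˣ) : R) • (A.trace • (1 : Matrix (Fin 2) (Fin 2) R) - A) := by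
  have hCH : A * (A.trace • (1 : Matrix (Fin 2) (Fin 2) R) - A) =
      A.det • (1 : Matrix (Fin 2) (Fin 2) R) := by
    rw [Matrix.mul_sub, Matrix.mul_smul, Matrix.mul_one, matrixTwo_mul_self]; abel
  refine Matrix.inv_eq_right_inv ?_
  rw [Matrix.mul_smul, hCH, smul_smul]
  rw [hu.val_inv_mul, one_smul]

/-- The inverse of `g ∈ R[A]` of unit determinant lies in `R[A]`. [folklore] -/
theorem inv_mem_adjoin_singleton_of_isUnit_det (A : Matrix (Fin 2) (Fin 2) R)
    {g : Matrix (Fin 2) (Fin 2) R} (hg : g ∈ Algebra.adjoin R {A}) (hu : IsUnit g.det) :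
    g⁻¹ ∈ Algebra.adjoin R {A} := by
  rw [inv_eq_smul_of_isUnit_det hu]
  exact Subalgebra.smul_mem _ (Subalgebra.sub_mem _
    (Subalgebra.smul_mem _ (Subalgebra.one_mem _) _) hg) _

/-- **`R[A] = R · 1 + R · A`** for any `A ∈ M₂(R)` (`R` non-trivial): by Cayley–Hamilton every
polynomial in `A` reduces to one of degree `≤ 1` (`Matrix.aeval_eq_aeval_mod_charpoly`).
[folklore] -/
theorem mem_adjoin_singleton_iff_exists [Nontrivial R] (A B : Matrix (Fin 2) (Fin 2) R) :
    B ∈ Algebra.adjoin R {A} ↔ ∃ p r : R, B = p • (1 : Matrix (Fin 2) (Fin 2) R) + r • A := by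
  constructor
  · intro hB
    rw [Algebra.adjoin_singleton_eq_range_aeval] at hB
    obtain ⟨q, rfl⟩ := hB
    have hne : A.charpoly ≠ 1 := by
      intro h
      have h2 := A.charpoly_natDegree_eq_dim
      rw [h, Polynomial.natDegree_one, Fintype.card_fin] at h2
      exact absurd h2 (by decide)
    have hdeg : (q %ₘ A.charpoly).natDegree ≤ 1 := by
      have hlt := Polynomial.natDegree_modByMonic_lt q A.charpoly_monic hne
      rw [Matrix.charpoly_natDegree_eq_dim, Fintype.card_fin] at hlt
      omega
    obtain ⟨a, b, hab⟩ : ∃ a b : R, q %ₘ A.charpoly = Polynomial.C b * Polynomial.X + Polynomial.C a :=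
      ⟨_, _, Polynomial.eq_X_add_C_of_natDegree_le_one hdeg⟩
    refine ⟨a, b, ?_⟩
    change Polynomial.aeval A q = _
    rw [Matrix.aeval_eq_aeval_mod_charpoly, hab]
    simp only [map_add, map_mul, Polynomial.aeval_C, Polynomial.aeval_X,
      Algebra.algebraMap_eq_smul_one, smul_mul_assoc, one_mul]
    rw [add_comm]
  · rintro ⟨p, r, rfl⟩
    exact Subalgebra.add_mem _ (Subalgebra.smul_mem _ (Subalgebra.one_mem _) p)
      (Subalgebra.smul_mem _ (Algebra.self_mem_adjoin_singleton R A) r)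

/-- `R[a] ≤ C(a)`: polynomials in `a` commute with `a` (any algebra over a commutative semiring;
the tree's `Algebra.adjoin_singleton_le_centralizer` is stated over fields). [folklore] -/
theorem adjoin_singleton_le_centralizer_singleton {S : Type*} [CommSemiring S] {B : Type*}
    [Semiring B] [Algebra S B] (a : B) :
    Algebra.adjoin S {a} ≤ Subalgebra.centralizer S ({a} : Set B) := by
  rw [Algebra.adjoin_le_iff, Set.singleton_subset_iff, SetLike.mem_coe,
    Subalgebra.mem_centralizer_iff]
  intro g hg
  rw [Set.mem_singleton_iff] at hg
  subst hg
  rfl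

/-- **The centraliser of a matrix conjugate to a companion matrix is `R[A]`** (`R` non-trivial).
[folklore] -/
theorem centralizer_singleton_eq_adjoin_of_conj_companion [Nontrivial R]
    {A P : Matrix (Fin 2) (Fin 2) R} {t n : R} (hP : IsUnit P.det)
    (hPA : P⁻¹ * A * P = !![0, -n; 1, t]) :
    Subalgebra.centralizer R ({A} : Set (Matrix (Fin 2) (Fin 2) R)) = Algebra.adjoin R {A} := by
  refine le_antisymm (fun B hB => ?_) (adjoin_singleton_le_centralizer_singleton A)
  rw [Subalgebra.mem_centralizer_iff] at hB
  obtain ⟨p, r, rfl⟩ := exists_eq_smul_one_add_smul_of_commute_of_conj_companion hP hPA (hB A rfl)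
  exact (mem_adjoin_singleton_iff_exists A _).mpr ⟨p, r, rfl⟩

end CommRing

/-! ### Over a field: scalar matrices, cyclic vectors, rational canonical form -/

section Field

variable {F : Type*} [Field F]

/-- A `2 × 2` matrix is scalar (`A ∈ F · 1 = ⊥`) iff its off-diagonal entries vanish and its
diagonal entries agree. [folklore] -/
theorem matrixTwo_mem_bot_iff {A : Matrix (Fin 2) (Fin 2) F} :
    A ∈ (⊥ : Subalgebra F (Matrix (Fin 2) (Fin 2) F)) ↔ A 0 1 = 0 ∧ A 1 0 = 0 ∧ A 0 0 = A 1 1 := by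
  rw [Algebra.mem_bot, Set.mem_range]
  constructor
  · rintro ⟨c, rfl⟩
    simp [Matrix.algebraMap_matrix_apply]
  · rintro ⟨h01, h10, h00⟩
    refine ⟨A 0 0, ?_⟩
    ext i j
    fin_cases i <;> fin_cases j <;> simp [Matrix.algebraMap_matrix_apply, h01, h10, h00]

/-- `c • 1 + d • A` is scalar only if `d = 0`, for a non-scalar `A`. [folklore] -/
theorem smul_one_add_smul_mem_bot_iff {A : Matrix (Fin 2) (Fin 2) F}
    (hA : A ∉ (⊥ : Subalgebra F (Matrix (Fin 2) (Fin 2) F))) (c d : F) :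
    c • (1 : Matrix (Fin 2) (Fin 2) F) + d • A ∈ (⊥ : Subalgebra F (Matrix (Fin 2) (Fin 2) F)) ↔
      d = 0 := by
  constructor
  · intro h
    by_contra hd
    apply hA
    have hc : c • (1 : Matrix (Fin 2) (Fin 2) F) ∈ (⊥ : Subalgebra F (Matrix (Fin 2) (Fin 2) F)) :=
      Subalgebra.smul_mem _ (Subalgebra.one_mem _) c
    have hdA : d • A ∈ (⊥ : Subalgebra F (Matrix (Fin 2) (Fin 2) F)) := by
      simpa using Subalgebra.sub_mem _ h hc
    simpa [smul_smul, inv_mul_cancel₀ hd] using Subalgebra.smul_mem _ hdA d⁻¹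
  · rintro rfl
    simpa using Subalgebra.smul_mem _ (Subalgebra.one_mem (⊥ : Subalgebra F _)) c

/-- The characteristic polynomial of a `2 × 2` matrix is determined by its trace and determinant
(`Matrix.charpoly_fin_two`). [folklore] -/
theorem charpoly_eq_of_trace_eq_of_det_eq {A B : Matrix (Fin 2) (Fin 2) F} (ht : A.trace = B.trace)
    (hd : A.det = B.det) : A.charpoly = B.charpoly := by
  rw [Matrix.charpoly_fin_two, Matrix.charpoly_fin_two, ht, hd]

/-- **A non-scalar `2 × 2` matrix has a cyclic vector**: some `v ∈ F²` with `v, Av` linearly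
independent, i.e. the matrix `[v | Av]` has non-zero determinant (take `v = e₁`, `e₂` or
`e₁ + e₂` according to which of `A₁₀ ≠ 0`, `A₀₁ ≠ 0`, `A₀₀ ≠ A₁₁` holds). [folklore] -/
theorem exists_det_cyclic_ne_zero {A : Matrix (Fin 2) (Fin 2) F}
    (hA : A ∉ (⊥ : Subalgebra F (Matrix (Fin 2) (Fin 2) F))) :
    ∃ v : Fin 2 → F, (!![v 0, (A *ᵥ v) 0; v 1, (A *ᵥ v) 1]).det ≠ 0 := by
  rw [matrixTwo_mem_bot_iff] at hA
  by_cases h10 : A 1 0 = 0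
  · by_cases h01 : A 0 1 = 0
    · have h00 : A 0 0 ≠ A 1 1 := fun h => hA ⟨h01, h10, h⟩
      refine ⟨![1, 1], ?_⟩
      simp [Matrix.det_fin_two, Matrix.mulVec, dotProduct, Fin.sum_univ_two, h10, h01]
      exact fun h => h00 (by linear_combination -h)
    · refine ⟨![0, 1], ?_⟩
      simpa [Matrix.det_fin_two, Matrix.mulVec, dotProduct, Fin.sum_univ_two] using h01
  · refine ⟨![1, 0], ?_⟩
    simpa [Matrix.det_fin_two, Matrix.mulVec, dotProduct, Fin.sum_univ_two] using h10

/-- **Rational canonical form in dimension `2`**: a non-scalar `A ∈ M₂(F)` is conjugate to the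
companion matrix of its characteristic polynomial, `P⁻¹ A P = !![0, -det A; 1, tr A]` for some
`P` with `det P ≠ 0` and indeed `A P = P C_A` (namely `P = [v | Av]` for a cyclic vector `v`).
[folklore] -/
theorem exists_conj_eq_companion {A : Matrix (Fin 2) (Fin 2) F}
    (hA : A ∉ (⊥ : Subalgebra F (Matrix (Fin 2) (Fin 2) F))) :
    ∃ P : Matrix (Fin 2) (Fin 2) F, P.det ≠ 0 ∧ A * P = P * !![0, -A.det; 1, A.trace] ∧
      P⁻¹ * A * P = !![0, -A.det; 1, A.trace] := by
  obtain ⟨v, hv⟩ := exists_det_cyclic_ne_zero hA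
  exact ⟨_, hv, mul_cyclic_eq_cyclic_mul_companion A v,
    inv_mul_mul_eq_of_mul_eq_mul (isUnit_iff_ne_zero.mpr hv) (mul_cyclic_eq_cyclic_mul_companion A v)⟩

/-- **Two non-scalar `2 × 2` matrices with the same trace and determinant are conjugate under
`GL₂(F)`**: `g A g⁻¹ = B` for some `g ∈ GL₂(F)` (both are conjugate to the common companion
matrix). The hypothesis that *both* are non-scalar is needed (`!![1, 1; 0, 1]` and `1` have the
same trace and determinant). (Gelbart (1975), p. 150, p. 155.) [folklore] -/
theorem exists_units_conj_eq_of_trace_eq_of_det_eq {A B : Matrix (Fin 2) (Fin 2) F}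
    (hA : A ∉ (⊥ : Subalgebra F (Matrix (Fin 2) (Fin 2) F)))
    (hB : B ∉ (⊥ : Subalgebra F (Matrix (Fin 2) (Fin 2) F)))
    (ht : A.trace = B.trace) (hd : A.det = B.det) :
    ∃ g : GL (Fin 2) F, (g : Matrix (Fin 2) (Fin 2) F) * A * ((g⁻¹ : GL (Fin 2) F) : Matrix _ _ F) =
      B := by
  obtain ⟨P, hP, -, hPA⟩ := exists_conj_eq_companion hA
  obtain ⟨Q, hQ, -, hQB⟩ := exists_conj_eq_companion hB
  rw [← ht, ← hd, ← hPA] at hQB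
  -- `Q⁻¹ B Q = P⁻¹ A P`, so `B = (Q P⁻¹) A (Q P⁻¹)⁻¹`
  have hPu : IsUnit P.det := isUnit_iff_ne_zero.mpr hP
  have hQu : IsUnit Q.det := isUnit_iff_ne_zero.mpr hQ
  have hPu' : IsUnit P := (Matrix.isUnit_iff_isUnit_det P).mpr hPu
  have hQu' : IsUnit Q := (Matrix.isUnit_iff_isUnit_det Q).mpr hQu
  refine ⟨hQu'.unit * (hPu'.unit)⁻¹, ?_⟩
  have h1 : ((hQu'.unit * hPu'.unit⁻¹ : (Matrix (Fin 2) (Fin 2) F)ˣ) : Matrix (Fin 2) (Fin 2) F) =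
      Q * P⁻¹ := by
    rw [Units.val_mul, IsUnit.unit_spec, Matrix.coe_units_inv, IsUnit.unit_spec]
  have h2 : (((hQu'.unit * hPu'.unit⁻¹)⁻¹ : (Matrix (Fin 2) (Fin 2) F)ˣ) : Matrix (Fin 2) (Fin 2) F) =
      P * Q⁻¹ := by
    rw [_root_.mul_inv_rev, inv_inv, Units.val_mul, IsUnit.unit_spec, Matrix.coe_units_inv,
      IsUnit.unit_spec]
  rw [h1, h2]
  -- `B = Q (Q⁻¹ B Q) Q⁻¹ = Q (P⁻¹ A P) Q⁻¹`
  have hB' : B = Q * (Q⁻¹ * B * Q) * Q⁻¹ := by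
    rw [← Matrix.mul_assoc, ← Matrix.mul_assoc, Matrix.mul_nonsing_inv _ hQu, Matrix.one_mul,
      Matrix.mul_assoc, Matrix.mul_nonsing_inv _ hQu, Matrix.mul_one]
  rw [hB', hQB]
  simp only [Matrix.mul_assoc]

/-- The determinant is a class function on `M₂(F)`: `det(g A g⁻¹) = det(A)`. [folklore] -/
theorem det_glTwo_conj (g : GL (Fin 2) F) (A : Matrix (Fin 2) (Fin 2) F) :
    ((g : Matrix (Fin 2) (Fin 2) F) * A * ((g⁻¹ : GL (Fin 2) F) : Matrix _ _ F)).det = A.det :=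
  Matrix.det_units_conj g A

/-- A conjugate `c γ' c⁻¹ = γ` in `GL₂(F)` has the same trace and determinant. [folklore] -/
theorem trace_eq_and_det_eq_of_isConj {γ γ' : GL (Fin 2) F} (h : IsConj γ' γ) :
    (γ : Matrix (Fin 2) (Fin 2) F).trace = (γ' : Matrix (Fin 2) (Fin 2) F).trace ∧
      (γ : Matrix (Fin 2) (Fin 2) F).det = (γ' : Matrix (Fin 2) (Fin 2) F).det := by
  obtain ⟨c, hc⟩ := isConj_iff.mp h
  have h1 : γ = c * γ' * c⁻¹ := hc.symm
  have h' : (γ : Matrix (Fin 2) (Fin 2) F) =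
      (c : Matrix (Fin 2) (Fin 2) F) * (γ' : Matrix (Fin 2) (Fin 2) F) *
        ((c⁻¹ : GL (Fin 2) F) : Matrix (Fin 2) (Fin 2) F) := by
    rw [h1, Units.val_mul, Units.val_mul]
  -- the trace is a class function: Mathlib's `Matrix.trace_units_conj` (at `m = Fin 2`)
  rw [h', Matrix.trace_units_conj, det_glTwo_conj]
  exact ⟨rfl, rfl⟩

/-- **Conjugacy classes of the non-scalar elements of `GL₂(F)` by trace and determinant** (the
`GL(2)` twin of `isConj_iff_reducedTrace_eq_and_reducedNorm_eq` for division quaternion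
algebras): for `γ, γ' ∈ GL₂(F)` both non-scalar, `γ'` is conjugate to `γ` iff `tr γ = tr γ'` and
`det γ = det γ'`. (Gelbart (1975), pp. 150, 154–155: the regular conjugacy classes indexed by
their characteristic polynomials.) [folklore] -/
theorem isConj_iff_trace_eq_and_det_eq {γ γ' : GL (Fin 2) F}
    (hγ : (γ : Matrix (Fin 2) (Fin 2) F) ∉ (⊥ : Subalgebra F (Matrix (Fin 2) (Fin 2) F)))
    (hγ' : (γ' : Matrix (Fin 2) (Fin 2) F) ∉ (⊥ : Subalgebra F (Matrix (Fin 2) (Fin 2) F))) :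
    IsConj γ' γ ↔ (γ : Matrix (Fin 2) (Fin 2) F).trace = (γ' : Matrix (Fin 2) (Fin 2) F).trace ∧
      (γ : Matrix (Fin 2) (Fin 2) F).det = (γ' : Matrix (Fin 2) (Fin 2) F).det := by
  refine ⟨trace_eq_and_det_eq_of_isConj, ?_⟩
  rintro ⟨ht, hd⟩
  obtain ⟨g, hg⟩ := exists_units_conj_eq_of_trace_eq_of_det_eq hγ' hγ ht.symm hd.symm
  exact isConj_iff.mpr ⟨g, Units.ext (by simpa only [Units.val_mul] using hg)⟩

/-! ### Centralisers: `C(A) = F[A]` for non-scalar `A` -/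

/-- **The centraliser of a non-scalar `A ∈ M₂(F)` is `F[A]`** (conjugate to the companion matrix,
whose commutant is `F · 1 + F · C`; Gelbart (1975), p. 154: `B_F(E)`, the centraliser of the
quadratic algebra `E = F(γ)`). [folklore] -/
theorem centralizer_singleton_eq_adjoin_of_not_mem_bot {A : Matrix (Fin 2) (Fin 2) F}
    (hA : A ∉ (⊥ : Subalgebra F (Matrix (Fin 2) (Fin 2) F))) :
    Subalgebra.centralizer F ({A} : Set (Matrix (Fin 2) (Fin 2) F)) = Algebra.adjoin F {A} := by
  obtain ⟨P, hP, -, hPA⟩ := exists_conj_eq_companion hA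
  exact centralizer_singleton_eq_adjoin_of_conj_companion (isUnit_iff_ne_zero.mpr hP) hPA

/-- The elements commuting with a non-scalar `A ∈ M₂(F)` are exactly the `p · 1 + r · A`.
[folklore] -/
theorem commute_iff_exists_of_not_mem_bot {A : Matrix (Fin 2) (Fin 2) F}
    (hA : A ∉ (⊥ : Subalgebra F (Matrix (Fin 2) (Fin 2) F))) (B : Matrix (Fin 2) (Fin 2) F) :
    A * B = B * A ↔ ∃ p r : F, B = p • (1 : Matrix (Fin 2) (Fin 2) F) + r • A := by
  obtain ⟨P, hP, -, hPA⟩ := exists_conj_eq_companion hA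
  refine ⟨fun h => exists_eq_smul_one_add_smul_of_commute_of_conj_companion
    (isUnit_iff_ne_zero.mpr hP) hPA h, ?_⟩
  rintro ⟨p, r, rfl⟩
  exact smul_one_add_smul_mul_comm A p r

/-- `1, A` are linearly independent for a non-scalar `A`. [folklore] -/
theorem linearIndependent_one_self_of_not_mem_bot {A : Matrix (Fin 2) (Fin 2) F}
    (hA : A ∉ (⊥ : Subalgebra F (Matrix (Fin 2) (Fin 2) F))) :
    LinearIndependent F ![(1 : Matrix (Fin 2) (Fin 2) F), A] := by
  rw [LinearIndependent.pair_iff]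
  intro s t hst
  have ht : t = 0 := by
    have hmem : s • (1 : Matrix (Fin 2) (Fin 2) F) + t • A ∈ (⊥ : Subalgebra F _) := by
      rw [hst]; exact Subalgebra.zero_mem _
    exact (smul_one_add_smul_mem_bot_iff hA s t).mp hmem
  subst ht
  rw [zero_smul, add_zero, smul_eq_zero] at hst
  exact ⟨hst.resolve_right one_ne_zero, rfl⟩

/-- **`dim_F F[A] = 2`** for a non-scalar `A ∈ M₂(F)` (`F[A] = F · 1 + F · A` with `1, A`
independent): `F(γ)` is a quadratic algebra. [folklore] -/
theorem finrank_adjoin_singleton_eq_two_of_not_mem_bot {A : Matrix (Fin 2) (Fin 2) F}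
    (hA : A ∉ (⊥ : Subalgebra F (Matrix (Fin 2) (Fin 2) F))) :
    finrank F (Algebra.adjoin F {A}) = 2 := by
  have hspan : Subalgebra.toSubmodule (Algebra.adjoin F {A}) =
      Submodule.span F (Set.range ![(1 : Matrix (Fin 2) (Fin 2) F), A]) := by
    apply le_antisymm
    · intro B hB
      obtain ⟨p, r, rfl⟩ := (mem_adjoin_singleton_iff_exists A B).mp hB
      exact Submodule.add_mem _ (Submodule.smul_mem _ _ (Submodule.subset_span ⟨0, rfl⟩))
        (Submodule.smul_mem _ _ (Submodule.subset_span ⟨1, rfl⟩))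
    · rw [Submodule.span_le]
      rintro _ ⟨i, rfl⟩
      fin_cases i
      · exact Subalgebra.one_mem _
      · exact Algebra.self_mem_adjoin_singleton F A
  rw [← Subalgebra.finrank_toSubmodule, hspan,
    finrank_span_eq_card (linearIndependent_one_self_of_not_mem_bot hA), Fintype.card_fin]

/-- `dim_F C(A) = 2` for a non-scalar `A ∈ M₂(F)`: the centraliser is a quadratic algebra.
[folklore] -/
theorem finrank_centralizer_singleton_eq_two_of_not_mem_bot {A : Matrix (Fin 2) (Fin 2) F}
    (hA : A ∉ (⊥ : Subalgebra F (Matrix (Fin 2) (Fin 2) F))) :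
    finrank F (Subalgebra.centralizer F ({A} : Set (Matrix (Fin 2) (Fin 2) F))) = 2 := by
  rw [centralizer_singleton_eq_adjoin_of_not_mem_bot hA]
  exact finrank_adjoin_singleton_eq_two_of_not_mem_bot hA

/-! ### Centralisers in `GL₂(F)` -/

/-- **In `GL₂(F)` the centraliser of a non-scalar `γ` is `F[γ]^×`** — the subgroup
`(F[γ]).toSubmonoid.units` of the units of `M₂(F)` lying in `F[γ]` (the `GL(2)` twin of
`Subgroup.centralizer_units_singleton_eq` for division quaternion algebras; Gelbart (1975),
p. 154: `B_F(E) = E^×` for `E = F(γ)`). [cite: Gelbart1975, p. 154] -/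
theorem glTwo_centralizer_singleton_eq {γ : GL (Fin 2) F}
    (hγ : (γ : Matrix (Fin 2) (Fin 2) F) ∉ (⊥ : Subalgebra F (Matrix (Fin 2) (Fin 2) F))) :
    Subgroup.centralizer ({γ} : Set (GL (Fin 2) F)) =
      (Algebra.adjoin F {(γ : Matrix (Fin 2) (Fin 2) F)}).toSubmonoid.units := by
  ext g
  rw [Subgroup.mem_centralizer_iff, Submonoid.mem_units_iff]
  simp only [Set.mem_singleton_iff, forall_eq]
  constructor
  · intro h
    have hg : (g : Matrix (Fin 2) (Fin 2) F) ∈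
        Subalgebra.centralizer F ({(γ : Matrix (Fin 2) (Fin 2) F)} : Set _) := by
      rw [Subalgebra.mem_centralizer_iff]
      intro d hd
      rw [Set.mem_singleton_iff] at hd
      subst hd
      exact_mod_cast h
    rw [centralizer_singleton_eq_adjoin_of_not_mem_bot hγ] at hg
    refine ⟨hg, ?_⟩
    change ((g⁻¹ : GL (Fin 2) F) : Matrix (Fin 2) (Fin 2) F) ∈ _
    rw [Matrix.coe_units_inv]
    exact inv_mem_adjoin_singleton_of_isUnit_det _ hg
      ((Matrix.isUnit_iff_isUnit_det _).mp g.isUnit)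
  · rintro ⟨hg, -⟩
    have hg' : (g : Matrix (Fin 2) (Fin 2) F) ∈
        Subalgebra.centralizer F ({(γ : Matrix (Fin 2) (Fin 2) F)} : Set _) := by
      rw [centralizer_singleton_eq_adjoin_of_not_mem_bot hγ]
      exact hg
    rw [Subalgebra.mem_centralizer_iff] at hg'
    exact Units.ext (hg' _ rfl)

/-- An element of `GL₂(F)` lying in the centraliser subalgebra `C(γ) ⊆ M₂(F)` of a non-scalar `γ`
commutes with `γ` in `GL₂(F)` (the units of the quadratic algebra `E = C(γ)` inside `GL₂(F)` are
the rational points `B_F(E)` of the torus; Gelbart (1975), p. 154). [cite: Gelbart1975, p. 154] -/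
theorem mem_glTwo_centralizer_iff_coe_mem (γ g : GL (Fin 2) F) :
    g ∈ Subgroup.centralizer ({γ} : Set (GL (Fin 2) F)) ↔
      (g : Matrix (Fin 2) (Fin 2) F) ∈
        Subalgebra.centralizer F ({(γ : Matrix (Fin 2) (Fin 2) F)} : Set (Matrix (Fin 2) (Fin 2) F)) := by
  rw [Subgroup.mem_centralizer_iff, Subalgebra.mem_centralizer_iff]
  simp only [Set.mem_singleton_iff, forall_eq]
  constructor
  · intro h
    exact_mod_cast h
  · intro h
    exact Units.ext h

/-! ### The elliptic case: irreducible characteristic polynomial -/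

/-- A matrix with irreducible characteristic polynomial is not scalar (a scalar `c · 1` has
characteristic polynomial `(X - c)²`, with the root `c`). [folklore] -/
theorem not_mem_bot_of_irreducible_charpoly {A : Matrix (Fin 2) (Fin 2) F}
    (hA : Irreducible A.charpoly) : A ∉ (⊥ : Subalgebra F (Matrix (Fin 2) (Fin 2) F)) := by
  intro h
  rw [Algebra.mem_bot] at h
  obtain ⟨c, rfl⟩ := h
  have hroot : (Matrix.charpoly (algebraMap F (Matrix (Fin 2) (Fin 2) F) c)).IsRoot c := by
    rw [Matrix.charpoly_fin_two, Polynomial.IsRoot.def]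
    simp [Matrix.algebraMap_matrix_apply, Matrix.trace_fin_two, Matrix.det_fin_two]
    ring
  have h1 := Polynomial.degree_eq_one_of_irreducible_of_root hA hroot
  rw [Matrix.charpoly_degree_eq_dim, Fintype.card_fin] at h1
  exact absurd h1 (by decide)

/-- For `A` with irreducible characteristic polynomial, `c² - tr(A) c + det(A) ≠ 0` for every
`c ∈ F` (no eigenvalue in `F`). [folklore] -/
theorem charpoly_eval_ne_zero_of_irreducible {A : Matrix (Fin 2) (Fin 2) F}
    (hA : Irreducible A.charpoly) (c : F) : c ^ 2 - A.trace * c + A.det ≠ 0 := by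
  intro hc
  have hroot : A.charpoly.IsRoot c := by
    rw [Matrix.charpoly_fin_two, Polynomial.IsRoot.def]
    simpa using hc
  have h1 := Polynomial.degree_eq_one_of_irreducible_of_root hA hroot
  rw [Matrix.charpoly_degree_eq_dim, Fintype.card_fin] at h1
  exact absurd h1 (by decide)

/-- **Every non-zero element of `F[A]` is a unit of `M₂(F)`** when the characteristic polynomial
of `A` is irreducible: `det(p · 1 + r · A) = r² χ_A(-p/r) ≠ 0` for `r ≠ 0`, `= p² ≠ 0` for
`r = 0`. So `E = F(γ)` sits in `GL₂(F) ∪ {0}` — the elliptic Cartan subgroup `E^×` of Gelbart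
(1975), p. 150. [cite: Gelbart1975, p. 150] -/
theorem isUnit_of_mem_adjoin_singleton_of_ne_zero {A : Matrix (Fin 2) (Fin 2) F}
    (hA : Irreducible A.charpoly) {B : Matrix (Fin 2) (Fin 2) F} (hB : B ∈ Algebra.adjoin F {A})
    (hB0 : B ≠ 0) : IsUnit B := by
  obtain ⟨p, r, rfl⟩ := (mem_adjoin_singleton_iff_exists A B).mp hB
  rw [Matrix.isUnit_iff_isUnit_det, isUnit_iff_ne_zero]
  have hdet : (p • (1 : Matrix (Fin 2) (Fin 2) F) + r • A).det =
      p ^ 2 + A.trace * p * r + A.det * r ^ 2 := by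
    simp [Matrix.det_fin_two, Matrix.trace_fin_two]
    ring
  rw [hdet]
  by_cases hr : r = 0
  · subst hr
    have hp : p ≠ 0 := by
      rintro rfl
      exact hB0 (by simp)
    simpa using pow_ne_zero 2 hp
  · intro h
    apply charpoly_eval_ne_zero_of_irreducible hA (-p / r)
    field_simp
    linear_combination h

/-- **`F[A]` is a field** when the characteristic polynomial of `A ∈ M₂(F)` is irreducible over
`F` (a quadratic field `E = F(γ) ⊂ M₂(F)`; Gelbart (1975), p. 150 and (10.17)–(10.18)).
[cite: Gelbart1975, p. 150] -/
theorem adjoin_singleton_isField_of_irreducible_charpoly {A : Matrix (Fin 2) (Fin 2) F}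
    (hA : Irreducible A.charpoly) : IsField (Algebra.adjoin F {A}) := by
  refine ⟨⟨0, 1, fun h => zero_ne_one (congrArg Subtype.val h)⟩,
    fun x y => Subtype.ext (Algebra.adjoin_singleton_comm (K := F) A x x.2 y y.2), ?_⟩
  intro x hx
  have hx0 : (x : Matrix (Fin 2) (Fin 2) F) ≠ 0 := fun h => hx (Subtype.ext h)
  have hu : IsUnit (x : Matrix (Fin 2) (Fin 2) F) :=
    isUnit_of_mem_adjoin_singleton_of_ne_zero hA x.2 hx0
  have hdet : IsUnit (x : Matrix (Fin 2) (Fin 2) F).det := (Matrix.isUnit_iff_isUnit_det _).mp hu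
  refine ⟨⟨(x : Matrix (Fin 2) (Fin 2) F)⁻¹, inv_mem_adjoin_singleton_of_isUnit_det A x.2 hdet⟩, ?_⟩
  exact Subtype.ext (Matrix.mul_nonsing_inv _ hdet)

/-- **Every non-zero element of the quadratic algebra `C(γ)` is a unit of `C(γ)`** when the
characteristic polynomial of `γ` is irreducible (the form consumed by Fujisaki's lemma for the
torus, `compactSpace_automorphicQuotient_units_of_forall_isUnit`). [cite: Gelbart1975, p. 150] -/
theorem forall_isUnit_centralizer_of_irreducible_charpoly {A : Matrix (Fin 2) (Fin 2) F}
    (hA : Irreducible A.charpoly) :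
    ∀ x : Subalgebra.centralizer F ({A} : Set (Matrix (Fin 2) (Fin 2) F)), x ≠ 0 → IsUnit x := by
  intro x hx
  have hx0 : (x : Matrix (Fin 2) (Fin 2) F) ≠ 0 := fun h => hx (Subtype.ext h)
  have hxA : (x : Matrix (Fin 2) (Fin 2) F) ∈ Algebra.adjoin F {A} := by
    rw [← centralizer_singleton_eq_adjoin_of_not_mem_bot (not_mem_bot_of_irreducible_charpoly hA)]
    exact x.2
  have hu : IsUnit (x : Matrix (Fin 2) (Fin 2) F) := isUnit_of_mem_adjoin_singleton_of_ne_zero hA hxA hx0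
  have hdet : IsUnit (x : Matrix (Fin 2) (Fin 2) F).det := (Matrix.isUnit_iff_isUnit_det _).mp hu
  have hinv : ∀ y : Matrix (Fin 2) (Fin 2) F, y ∈ Algebra.adjoin F {A} → IsUnit y.det →
      y⁻¹ ∈ Subalgebra.centralizer F ({A} : Set (Matrix (Fin 2) (Fin 2) F)) := by
    intro y hy hyu
    rw [centralizer_singleton_eq_adjoin_of_not_mem_bot (not_mem_bot_of_irreducible_charpoly hA)]
    exact inv_mem_adjoin_singleton_of_isUnit_det A hy hyu
  refine ⟨⟨x, ⟨_, hinv _ hxA hdet⟩, Subtype.ext ?_, Subtype.ext ?_⟩, rfl⟩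
  · exact Matrix.mul_nonsing_inv _ hdet
  · exact Matrix.nonsing_inv_mul _ hdet

/-- **Elliptic conjugacy classes of `GL₂(F)` by trace and determinant**: if the characteristic
polynomial of `γ ∈ GL₂(F)` is irreducible over `F`, then *any* `γ' ∈ GL₂(F)` with `tr γ' = tr γ`
and `det γ' = det γ` is conjugate to `γ` (such a `γ'` has the same, irreducible, characteristic
polynomial, hence is non-scalar). This is the indexing of the elliptic terms of (10.15)/(10.18)
by "the equivalence classes of all quadratic extensions `E` of `F`" together with a generator
(Gelbart (1975), p. 155). [cite: Gelbart1975, pp. 154–155] -/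
theorem isConj_iff_of_irreducible_charpoly {γ γ' : GL (Fin 2) F}
    (hγ : Irreducible (γ : Matrix (Fin 2) (Fin 2) F).charpoly) :
    IsConj γ' γ ↔ (γ : Matrix (Fin 2) (Fin 2) F).trace = (γ' : Matrix (Fin 2) (Fin 2) F).trace ∧
      (γ : Matrix (Fin 2) (Fin 2) F).det = (γ' : Matrix (Fin 2) (Fin 2) F).det := by
  refine ⟨trace_eq_and_det_eq_of_isConj, ?_⟩
  rintro ⟨ht, hd⟩
  have hγ' : Irreducible (γ' : Matrix (Fin 2) (Fin 2) F).charpoly := by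
    rwa [← charpoly_eq_of_trace_eq_of_det_eq ht hd]
  exact (isConj_iff_trace_eq_and_det_eq (not_mem_bot_of_irreducible_charpoly hγ)
    (not_mem_bot_of_irreducible_charpoly hγ')).mpr ⟨ht, hd⟩

end Field

end Literature.NumberTheory.Automorphic
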